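import Summits.ResolutionOfSingularities.ResolutionOfSingularities.Theorems.FrobeniusLadderFInjectiveMacaulayficationFilteredChartIso
import Summits.ResolutionOfSingularities.ResolutionOfSingularities.Theorems.FrobeniusLadderFInjectiveMacaulayficationFilteredReesInterface
import Summits.ResolutionOfSingularities.ResolutionOfSingularities.Theorems.FrobeniusLadderFInjectiveMacaulayficationFilteredReesChartCore
import Summits.ResolutionOfSingularities.ResolutionOfSingularities.Theorems.FrobeniusLadderFInjectiveMacaulayficationFilteredReesDomain
import Summits.ResolutionOfSingularities.ResolutionOfSingularities.Theorems.FrobeniusLadderFInjectiveMacaulayficationRingVeronese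
import Summits.ResolutionOfSingularities.ResolutionOfSingularities.Theorems.FrobeniusLadderFInjectiveMacaulayficationGradedChartDescent
import HarnessLib

/-!
# G4♮ `stub_filteredChartClause`: THE FILTERED CHART CLAUSE (crux `FInjectiveMacaulayfication`, §17 filtered engine)

Proof file for the registered stub G4♮ `stub_filteredChartClause` of crux stmt-ResolutionOfSingularities-15315
(`FrobeniusLadder.FInjectiveMacaulayfication`), skeleton v13 `45d06e4e` §17b (CRUX-PLAN w45a v5/v6, piece (F6); lead seat
res-L1-w45a-lead-1). [OURS · L1 W4.5a] — AI-written, weaker than expert review; not a statement of any manuscript.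

THE STATEMENT. `f ∈ k[X₁..Xₙ]` ARBITRARY with `(f)` prime and no `x̄ⱼ = 0`, `f₀` its initial `w`-form (`D = ord_w f`), `N = c·w_v`,
Veronese saturation of `I_N`; if the weighted TANGENT CONE `k[X]/(f₀)` satisfies the Cohen–Macaulay + Frobenius-closed clause at
its maximal ideals missing a variable, then the chart `R[I_N R/x̄_v^c]` of the weighted blow-up of `R = k[X]/(f)` satisfies the
clause at its maximal ideals containing `x̄_v^c` — every `p`.

THE PROOF = deformation to the weighted tangent cone, assembled from the chain's landed pieces: the carrier `T′♮ = (k[X,s]/(f^h))[1/X_v^c]`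
(stub-3, `FilteredReesCarrier` p488836; domain/instances `FilteredReesDomain` p490979), its `(w,−1)`-coaction (stub-4,
`WeightCoactionZ`), the degree-`0` subalgebra `T₀` (`RingVeronese.exists_degSubalgebra`), THE FILTERED CHART ISO `ι♮ : C_v ≃ T₀`
(lead-1, `FilteredChartIso` p492316), the Rees–Veronese interface in CPS form (stub-4, `FilteredReesInterface`), and the chart core
(stub-3, `FilteredReesChartCore.filteredChartClause_core` p491923 = stub-2's `chartClause_core_affine` on `T′♮` with the cone
clause `FilteredReesConeClause` p491511 via Fedder deformation and finite graded + Laurent descent). No definitions, no named facts.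
[folklore]
-/

set_option linter.dupNamespace false

noncomputable section

open scoped LaurentPolynomial
open AddMonoidAlgebra LaurentPolynomial AlgebraicGeometry Literature.AlgebraicGeometry.Resolution

namespace Summit.ResolutionOfSingularities.ResolutionOfSingularities.Theorems.FInjectiveMacaulayfication.FilteredChartClause

open Summit.ResolutionOfSingularities.ResolutionOfSingularities.Theorems.FInjectiveMacaulayfication

set_option maxHeartbeats 800000 in
/-- G4♮ **THE FILTERED CHART CLAUSE** (registered stub `stub_filteredChartClause`, skeleton v13): the chart clause for the weighted
blow-up of an ARBITRARY prime hypersurface `f` from the clause off the origin of its weighted tangent cone `k[X]/(f₀)` — module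
docstring. [folklore] -/
theorem stub_filteredChartClause : ∀ (p : ℕ) [Fact p.Prime] (k : Type) [Field k] [CharP k p] (n : ℕ) (w : Fin n → ℕ) (v : Fin n),
    0 < w v → ∀ (N c D : ℕ), c * w v = N → 0 < c →
    (∀ (K : ℕ) (b : Fin n →₀ ℕ), K * N ≤ Finsupp.weight w b → (MvPolynomial.monomial b (1 : k) : MvPolynomial (Fin n) k) ∈
      (Ideal.span {m : MvPolynomial (Fin n) k | ∃ b : Fin n →₀ ℕ, N ≤ Finsupp.weight w b ∧ m = MvPolynomial.monomial b 1}) ^ K) →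
    ∀ (f f₀ : MvPolynomial (Fin n) k), f₀ = MvPolynomial.weightedHomogeneousComponent w D f →
    (∀ m < D, MvPolynomial.weightedHomogeneousComponent w m f = 0) → f₀ ≠ 0 → (Ideal.span {f}).IsPrime →
    (∀ j : Fin n, Ideal.Quotient.mk (Ideal.span {f}) (MvPolynomial.X j) ≠ 0) →
    (∀ (Q : Ideal (MvPolynomial (Fin n) k ⧸ Ideal.span {f₀})) [Q.IsMaximal],
      (∃ j : Fin n, Ideal.Quotient.mk (Ideal.span {f₀}) (MvPolynomial.X j) ∉ Q) →
      ∀ d : ℕ, ringKrullDim (Localization.AtPrime Q) = d → ∀ s : Fin d → Localization.AtPrime Q,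
        (Ideal.span (Set.range s)).radical.IsMaximal →
          RingTheory.Sequence.IsWeaklyRegular (Localization.AtPrime Q) (List.ofFn s) ∧
          ∀ y : Localization.AtPrime Q, (∃ e : ℕ, y ^ p ^ e ∈ Ideal.span
            ((fun z : Localization.AtPrime Q => z ^ p ^ e) ''
              (Ideal.span (Set.range s) : Set (Localization.AtPrime Q)))) → y ∈ Ideal.span (Set.range s)) →
    ∀ (Q : Ideal (blowupAlgebra ((Ideal.span {m : MvPolynomial (Fin n) k | ∃ b : Fin n →₀ ℕ, N ≤ Finsupp.weight w b ∧
        m = MvPolynomial.monomial b 1}).map (Ideal.Quotient.mk (Ideal.span {f}))) (Ideal.Quotient.mk (Ideal.span {f}) (MvPolynomial.X v) ^ c)))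
      [Q.IsMaximal],
      algebraMap (MvPolynomial (Fin n) k ⧸ Ideal.span {f}) (blowupAlgebra ((Ideal.span {m : MvPolynomial (Fin n) k | ∃ b : Fin n →₀ ℕ,
        N ≤ Finsupp.weight w b ∧ m = MvPolynomial.monomial b 1}).map (Ideal.Quotient.mk (Ideal.span {f})))
          (Ideal.Quotient.mk (Ideal.span {f}) (MvPolynomial.X v) ^ c)) (Ideal.Quotient.mk (Ideal.span {f}) (MvPolynomial.X v) ^ c) ∈ Q →
      ∀ d : ℕ, ringKrullDim (Localization.AtPrime Q) = d → ∀ s : Fin d → Localization.AtPrime Q,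
        (Ideal.span (Set.range s)).radical.IsMaximal →
          RingTheory.Sequence.IsWeaklyRegular (Localization.AtPrime Q) (List.ofFn s) ∧
          ∀ y : Localization.AtPrime Q, (∃ e : ℕ, y ^ p ^ e ∈ Ideal.span
            ((fun z : Localization.AtPrime Q => z ^ p ^ e) ''
              (Ideal.span (Set.range s) : Set (Localization.AtPrime Q)))) → y ∈ Ideal.span (Set.range s) := by
  intro p _ k _ _ n w v hw N c D hcN hc hpow f f₀ hf₀ hD0 hD hfprime hXne hoff₀ Q _ huQ
  classical
  haveI := hfprime
  haveI : IsDomain (MvPolynomial (Fin n) k ⧸ Ideal.span {f}) := Ideal.Quotient.isDomain _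
  have hN : 0 < N := hcN ▸ Nat.mul_pos hc hw
  -- the carrier `f^h`
  obtain ⟨fh, hfh⟩ : ∃ fh : MvPolynomial (Option (Fin n)) k, fh = ∑ b ∈ f.support, MvPolynomial.monomial
      (Finsupp.mapDomain some b + Finsupp.single none (Finsupp.weight w b - D)) (MvPolynomial.coeff b f) := ⟨_, rfl⟩
  have hf0 : MvPolynomial.weightedHomogeneousComponent w D f ≠ 0 := hf₀ ▸ hD
  haveI hfhprime : (Ideal.span {fh}).IsPrime := by
    haveI := FilteredReesDomain.isDomain_rees w D f fh hfh hD0 hf0 hfprime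
    exact (Ideal.Quotient.isDomain_iff_prime _).mp inferInstance
  -- the coaction on `T′♮`
  obtain ⟨β, hβX, hβk, hβhom, -, -⟩ := WeightCoactionZ.exists_weightCoactionZ
    (fun o : Option (Fin n) => o.elim (-1 : ℤ) (fun j => (w j : ℤ))) fh (D : ℤ)
    (FilteredReesCarrier.fh_isWeightedHomogeneous w D f fh hfh hD0) (MvPolynomial.X (some v) ^ c) (N : ℤ) (by
      have h1 := (MvPolynomial.isWeightedHomogeneous_X k (fun o : Option (Fin n) => o.elim (-1 : ℤ) (fun j => (w j : ℤ)))
        (some v)).pow c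
      rwa [Option.elim_some, nsmul_eq_mul, ← Nat.cast_mul, hcN] at h1)
    (Ideal.Quotient.mk (Ideal.span {fh}) (MvPolynomial.X (some v)) ^ c) (map_pow _ _ _)
  -- the characterising identity in `aeval` form
  have hlam : ∀ a : MvPolynomial (Option (Fin n)) k,
      β (algebraMap (MvPolynomial (Option (Fin n)) k ⧸ Ideal.span {fh}) _ (Ideal.Quotient.mk (Ideal.span {fh}) a)) =
        MvPolynomial.aeval (fun o : Option (Fin n) => single (o.elim (-1 : ℤ) (fun j => (w j : ℤ)))
          (algebraMap (MvPolynomial (Option (Fin n)) k ⧸ Ideal.span {fh})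
            (Localization.Away (Ideal.Quotient.mk (Ideal.span {fh}) (MvPolynomial.X (some v)) ^ c))
            (Ideal.Quotient.mk (Ideal.span {fh}) (MvPolynomial.X o)))) a := by
    intro a
    have h : (β.comp (algebraMap (MvPolynomial (Option (Fin n)) k ⧸ Ideal.span {fh}) _)).comp (Ideal.Quotient.mk (Ideal.span {fh})) =
        (MvPolynomial.aeval (fun o : Option (Fin n) => single (o.elim (-1 : ℤ) (fun j => (w j : ℤ)))
          (algebraMap (MvPolynomial (Option (Fin n)) k ⧸ Ideal.span {fh})
            (Localization.Away (Ideal.Quotient.mk (Ideal.span {fh}) (MvPolynomial.X (some v)) ^ c))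
            (Ideal.Quotient.mk (Ideal.span {fh}) (MvPolynomial.X o))))).toRingHom := by
      refine MvPolynomial.ringHom_ext (fun r => ?_) (fun o => ?_)
      · rw [RingHom.comp_apply, RingHom.comp_apply, AlgHom.toRingHom_eq_coe, RingHom.coe_coe, MvPolynomial.aeval_C,
          ← MvPolynomial.algebraMap_eq, Ideal.Quotient.mk_algebraMap, ← IsScalarTower.algebraMap_apply, hβk,
          LaurentPolynomial.algebraMap_apply, ← single_eq_C]
      · rw [RingHom.comp_apply, RingHom.comp_apply, AlgHom.toRingHom_eq_coe, RingHom.coe_coe, MvPolynomial.aeval_X, hβX]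
    exact RingHom.congr_fun h a
  -- the degree-0 subalgebra and the filtered chart iso
  obtain ⟨T₀, hT₀⟩ := RingVeronese.exists_degSubalgebra (k := k) β (fun r => by rw [hβk, ← single_eq_C])
  have hι' := FilteredChartIso.exists_filteredChartIso w f D fh hfh hD0 hf0 hfprime hfhprime v (hXne v) N c hcN hpow β hβhom T₀ hT₀
  obtain ⟨ι, hιu⟩ := hι'
  -- instances on the chart
  haveI : Algebra.FiniteType (MvPolynomial (Fin n) k ⧸ Ideal.span {f}) (blowupAlgebra ((Ideal.span {m : MvPolynomial (Fin n) k |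
      ∃ b : Fin n →₀ ℕ, N ≤ Finsupp.weight w b ∧ m = MvPolynomial.monomial b 1}).map (Ideal.Quotient.mk (Ideal.span {f})))
      (Ideal.Quotient.mk (Ideal.span {f}) (MvPolynomial.X v) ^ c)) :=
    GradedChartDescent.finiteType_blowupAlgebra _ (IsNoetherian.noetherian _) _
  haveI : IsNoetherianRing (blowupAlgebra ((Ideal.span {m : MvPolynomial (Fin n) k |
      ∃ b : Fin n →₀ ℕ, N ≤ Finsupp.weight w b ∧ m = MvPolynomial.monomial b 1}).map (Ideal.Quotient.mk (Ideal.span {f})))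
      (Ideal.Quotient.mk (Ideal.span {f}) (MvPolynomial.X v) ^ c)) :=
    Algebra.FiniteType.isNoetherianRing (MvPolynomial (Fin n) k ⧸ Ideal.span {f}) _
  haveI : IsDomain (Localization.Away (Ideal.Quotient.mk (Ideal.span {f}) (MvPolynomial.X v) ^ c)) :=
    IsLocalization.isDomain_localization (powers_le_nonZeroDivisors_of_noZeroDivisors (pow_ne_zero c (hXne v)))
  haveI : CharP (blowupAlgebra ((Ideal.span {m : MvPolynomial (Fin n) k |
      ∃ b : Fin n →₀ ℕ, N ≤ Finsupp.weight w b ∧ m = MvPolynomial.monomial b 1}).map (Ideal.Quotient.mk (Ideal.span {f})))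
      (Ideal.Quotient.mk (Ideal.span {f}) (MvPolynomial.X v) ^ c)) p :=
    charP_of_injective_algebraMap (algebraMap k _).injective p
  -- the Rees–Veronese interface, then the chart core
  exact FilteredReesInterface.filteredReesInterface n w v hw N c D hcN hc f fh hfh hD0 β hlam T₀ hT₀ ι _ hιu _
    (fun A' _ ρ hρ hsN T _ ι' e heN => FilteredReesChartCore.filteredChartClause_core p k n w D f fh hfh hD0 f₀ hf₀ hD hfprime
      hXne v c hc hoff₀ A' ρ hρ N hsN _ T ι' e _ heN Q huQ)

end Summit.ResolutionOfSingularities.ResolutionOfSingularities.Theorems.FInjectiveMacaulayfication.FilteredChartClause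

end
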